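import Summits.HodgeConjecture.CorCM.Census.CentralSquaresDihedralM2
import Summits.HodgeConjecture.CorCM.Census.CentralSquaresSemidirect

/-!
# The square-central class, XXIII: THE COMPLETE DIHEDRAL QUOTIENT LAW — every nontrivial kernel — and the rows `D₄ × E`, `N ⋊ D₄` for `|E|, |N| ≥ 2`

COR-CM (cell `pub-hodgecm2`), count-neutral kernel combinatorics by the binder seat b09 (gen 46; lane SQUARE-CENTRAL CLASS, part XXIII), combining part X
(`isLeast_card_gfaces_generate_of_dihedral_quotient`, kernel `≥ 4`) with part XXII (`…_of_dihedral_quotient_two`, kernel `= 2`), and part XIʼs fibre count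
(`fibreTwo_add_two_eq_card_block_of_dihedral_quotient'`), BY NAME; the product and semidirect instances follow parts IX/XI/XII.  Theorems only: no definition,
no certificate, no named fact, no `sorry`.  HONEST FRAMING: `HC_CM` is NOT proved, here or anywhere in the tree; nothing here is a period or a headline.

* §1 **`isLeast_card_gfaces_generate_of_dihedral_quotient'`**: `G` a finite `2`-group, `c` a central involution, `π : G ↠ D₄` with `π c = r²` and
  NONTRIVIAL kernel, `s` lifting to an involution ⟹ **`μ(G, c) = φ₂(G, c) = β(G, c) − 2`** (`…_block'`).  (A trivial kernel is `G = D₄`, `n = 4`, outside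
  the four-type frame; the dihedral law of b23 covers it.)
* §2 **`D₄ × E` for EVERY finite group `E` of order `2ᵏ ≥ 2`** (`isLeast_card_gfaces_generate_dihedral_prod'`, `…_block'`) — part IX needed `|E| ≥ 4`;
  the new row is `D₄ × ℤ/2` (`β = 26`, `μ = φ₂ = 24`).
* §3 **`N ⋊[φ] D₄` for `|N| = 2ᵏ ≥ 2`**, `r²` acting trivially (`isLeast_card_gfaces_generate_semidirect'`, `…_block'`).

## References
* [Pohlmann1968] H. Pohlmann, Algebraic cycles on abelian varieties of complex multiplication type, Ann. of Math. 88 (1968), Thm 1.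
* [Milne1999] J. S. Milne, Lefschetz motives and the Tate conjecture, Compositio Math. 117 (1999), Prop. 2.1, p. 54.
-/

namespace Summit.HodgeConjecture.CorCM.Census.CentralSquares

open Finset DihedralGroup
open Summit.HodgeConjecture.CorCM.Prior.AllgGroup.RfwfAllgGroup
open Summit.HodgeConjecture.CorCM.Census.BlockParity
open Summit.HodgeConjecture.CorCM.Census.Coinvariant
open Summit.HodgeConjecture.CorCM.Census.TwistGeneration
open Summit.HodgeConjecture.CorCM.Census.BaseBlock

noncomputable section

variable {G : Type*} [Group G] [Fintype G] [DecidableEq G]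

/-! ## §1 The complete dihedral quotient law -/

/-- **THE COMPLETE DIHEDRAL QUOTIENT LAW.**  `G` a finite `2`-group, `c` a central involution, `π : G →* D₄` surjective with `π c = r²` and nontrivial kernel,
and an involution `q ∈ G` over the reflection `s`: **`μ(G, c) = φ₂(G, c)`**. [folklore] -/
theorem isLeast_card_gfaces_generate_of_dihedral_quotient' {c : G} (hG : IsPGroup 2 G) (hc2 : c * c = 1) (hcen : ∀ x : G, x * c = c * x)
    (π : G →* DihedralGroup 4) (hπ : Function.Surjective π) (hπc : π c = r 2) (hker : 2 ≤ Nat.card π.ker)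
    (q : G) (hπq : π q = sr 0) (hqq : q * q = 1) :
    IsLeast {n : ℕ | ∃ S : Finset (CMF G c →₀ ℤ), (↑S ⊆ gfaceSet G c hc2) ∧ S.card = n ∧
      hodgeSpan c hc2 ≤ Submodule.span ℤ (pairSet c) ⊔ Submodule.span ℤ (translates c S)} (fibreTwo c hc2) := by
  obtain ⟨k, hk⟩ := IsPGroup.iff_card.mp (hG.to_subgroup π.ker)
  by_cases hk1 : k = 1
  · rw [hk1, pow_one] at hk
    exact isLeast_card_gfaces_generate_of_dihedral_quotient_two hc2 hcen π hπ hπc hk q hπq hqq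
  · have hk2 : 2 ≤ k := by
      rcases k with _ | _ | k
      · rw [hk] at hker; norm_num at hker
      · exact absurd rfl hk1
      · omega
    have h4 : 4 ≤ Nat.card π.ker := by
      rw [hk]
      calc 4 = 2 ^ 2 := by norm_num
        _ ≤ 2 ^ k := Nat.pow_le_pow_right (by norm_num) hk2
    exact isLeast_card_gfaces_generate_of_dihedral_quotient hG hc2 hcen π hπ hπc h4 q hπq hqq

/-- **`μ = β − 2` for every dihedral quotient `2`-group with nontrivial kernel and an involution over `s`.** [folklore] -/
theorem isLeast_card_gfaces_generate_of_dihedral_quotient_block' {c : G} (hG : IsPGroup 2 G) (hc2 : c * c = 1) (hcen : ∀ x : G, x * c = c * x)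
    (π : G →* DihedralGroup 4) (hπ : Function.Surjective π) (hπc : π c = r 2) (hker : 2 ≤ Nat.card π.ker)
    (q : G) (hπq : π q = sr 0) (hqq : q * q = 1) :
    IsLeast {n : ℕ | ∃ S : Finset (CMF G c →₀ ℤ), (↑S ⊆ gfaceSet G c hc2) ∧ S.card = n ∧
      hodgeSpan c hc2 ≤ Submodule.span ℤ (pairSet c) ⊔ Submodule.span ℤ (translates c S)} (Fintype.card (Block c) - 2) := by
  have h := fibreTwo_add_two_eq_card_block_of_dihedral_quotient' hG hc2 hcen π hπ hπc
  rw [show Fintype.card (Block c) - 2 = fibreTwo c hc2 by omega]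
  exact isLeast_card_gfaces_generate_of_dihedral_quotient' hG hc2 hcen π hπ hπc hker q hπq hqq

/-! ## §2 The rows `D₄ × E`, `|E| = 2ᵏ ≥ 2` -/

section Prod

variable (E : Type) [Group E] [Fintype E] [DecidableEq E]

omit [DecidableEq E] in
/-- The kernel of the first projection `D₄ × E → D₄` has `|E|` elements. [folklore] -/
theorem card_ker_fst : Nat.card (MonoidHom.fst (DihedralGroup 4) E).ker = Fintype.card E := by
  classical
  have h := card_filter_comap (MonoidHom.fst (DihedralGroup 4) E) Prod.fst_surjective ({r 0} : Finset (DihedralGroup 4))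
  have h2 : (univ.filter fun g : DihedralGroup 4 × E => (MonoidHom.fst (DihedralGroup 4) E) g ∈ ({r 0} : Finset (DihedralGroup 4))) =
      ({r 0} : Finset (DihedralGroup 4)) ×ˢ (univ : Finset E) := by
    ext g; simp only [mem_filter, mem_univ, true_and, MonoidHom.coe_fst, mem_product, and_true]
  rw [h2, card_product, card_singleton, one_mul, card_univ] at h
  rw [one_mul] at h
  exact h.symm

/-- **THE DIHEDRAL FACTOR LAW, all orders.**  `E` a finite group of order `2ᵏ`, `k ≥ 1`; `G = D₄ × E`, `c = (r², 1)`: **`μ(G, c) = φ₂(G, c)`** — part IX for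
`k ≥ 2`, part XXII for `k = 1` (`D₄ × ℤ/2`). [folklore] -/
theorem isLeast_card_gfaces_generate_dihedral_prod' (k : ℕ) (hk : 1 ≤ k) (hE : Fintype.card E = 2 ^ k) :
    IsLeast {n : ℕ | ∃ S : Finset (CMF (DihedralGroup 4 × E) ((r 2, 1) : DihedralGroup 4 × E) →₀ ℤ),
      (↑S ⊆ gfaceSet (DihedralGroup 4 × E) ((r 2, 1) : DihedralGroup 4 × E) (prod_c_mul_c E)) ∧ S.card = n ∧
      hodgeSpan ((r 2, 1) : DihedralGroup 4 × E) (prod_c_mul_c E) ≤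
        Submodule.span ℤ (pairSet ((r 2, 1) : DihedralGroup 4 × E)) ⊔ Submodule.span ℤ (translates ((r 2, 1) : DihedralGroup 4 × E) S)}
      (fibreTwo ((r 2, 1) : DihedralGroup 4 × E) (prod_c_mul_c E)) := by
  classical
  have hG : IsPGroup 2 (DihedralGroup 4 × E) := by
    refine IsPGroup.of_card (n := k + 3) ?_
    rw [Nat.card_eq_fintype_card, Fintype.card_prod, hE, DihedralGroup.card]; ring
  have hcen : ∀ x : DihedralGroup 4 × E, x * (r 2, 1) = (r 2, 1) * x := by
    intro x; ext
    · change x.1 * r 2 = r 2 * x.1; have h : ∀ d : DihedralGroup 4, d * r 2 = r 2 * d := by decide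
      exact h x.1
    · change x.2 * 1 = 1 * x.2; rw [mul_one, one_mul]
  have hker : 2 ≤ Nat.card (MonoidHom.fst (DihedralGroup 4) E).ker := by
    rw [card_ker_fst, hE]
    calc 2 = 2 ^ 1 := by norm_num
      _ ≤ 2 ^ k := Nat.pow_le_pow_right (by norm_num) hk
  exact isLeast_card_gfaces_generate_of_dihedral_quotient' hG (prod_c_mul_c E) hcen (MonoidHom.fst (DihedralGroup 4) E)
    Prod.fst_surjective rfl hker ((sr 0, 1) : DihedralGroup 4 × E) rfl (prod_Q_mul_Q E)

/-- **`μ = β − 2` for `(D₄ × E, (r², 1))`**, `E` any finite group of order `2ᵏ ≥ 2` — in particular `D₄ × ℤ/2`: `β = 26`, `μ = 24`. [folklore] -/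
theorem isLeast_card_gfaces_generate_dihedral_prod_block' (k : ℕ) (hk : 1 ≤ k) (hE : Fintype.card E = 2 ^ k) :
    IsLeast {n : ℕ | ∃ S : Finset (CMF (DihedralGroup 4 × E) ((r 2, 1) : DihedralGroup 4 × E) →₀ ℤ),
      (↑S ⊆ gfaceSet (DihedralGroup 4 × E) ((r 2, 1) : DihedralGroup 4 × E) (prod_c_mul_c E)) ∧ S.card = n ∧
      hodgeSpan ((r 2, 1) : DihedralGroup 4 × E) (prod_c_mul_c E) ≤
        Submodule.span ℤ (pairSet ((r 2, 1) : DihedralGroup 4 × E)) ⊔ Submodule.span ℤ (translates ((r 2, 1) : DihedralGroup 4 × E) S)}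
      (Fintype.card (Block ((r 2, 1) : DihedralGroup 4 × E)) - 2) := by
  have h := fibreTwo_add_two_eq_card_block_dihedral_prod E k hE
  rw [show Fintype.card (Block ((r 2, 1) : DihedralGroup 4 × E)) - 2 = fibreTwo ((r 2, 1) : DihedralGroup 4 × E) (prod_c_mul_c E) by
    omega]
  exact isLeast_card_gfaces_generate_dihedral_prod' E k hk hE

end Prod

/-! ## §3 The rows `N ⋊ D₄`, `|N| = 2ᵏ ≥ 2` -/

/-- **`μ = φ₂` for the split extensions `(N ⋊[φ] D₄, inr r²)`**, `|N| = 2ᵏ ≥ 2`, `r²` acting trivially. [folklore] -/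
theorem isLeast_card_gfaces_generate_semidirect' (N : Type*) [Group N] [Fintype N] [DecidableEq N]
    (φ : DihedralGroup 4 →* MulAut N) (hφ : φ (r 2) = 1) [Fintype (N ⋊[φ] DihedralGroup 4)] (k : ℕ) (hk : 1 ≤ k)
    (hN : Fintype.card N = 2 ^ k) :
    IsLeast {n : ℕ | ∃ S : Finset (CMF (N ⋊[φ] DihedralGroup 4) (SemidirectProduct.inr (r 2)) →₀ ℤ),
      (↑S ⊆ gfaceSet (N ⋊[φ] DihedralGroup 4) (SemidirectProduct.inr (r 2)) (semidirect_c_mul_c N φ)) ∧ S.card = n ∧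
      hodgeSpan (SemidirectProduct.inr (r 2) : N ⋊[φ] DihedralGroup 4) (semidirect_c_mul_c N φ) ≤
        Submodule.span ℤ (pairSet (SemidirectProduct.inr (r 2) : N ⋊[φ] DihedralGroup 4)) ⊔
          Submodule.span ℤ (translates (SemidirectProduct.inr (r 2) : N ⋊[φ] DihedralGroup 4) S)}
      (fibreTwo (SemidirectProduct.inr (r 2) : N ⋊[φ] DihedralGroup 4) (semidirect_c_mul_c N φ)) := by
  have hker : 2 ≤ Nat.card (SemidirectProduct.rightHom : N ⋊[φ] DihedralGroup 4 →* DihedralGroup 4).ker := by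
    rw [semidirect_card_ker, hN]
    calc 2 = 2 ^ 1 := by norm_num
      _ ≤ 2 ^ k := Nat.pow_le_pow_right (by norm_num) hk
  have hqq : (SemidirectProduct.inr (sr 0) : N ⋊[φ] DihedralGroup 4) * SemidirectProduct.inr (sr 0) = 1 := by
    rw [← map_mul, show (sr 0 : DihedralGroup 4) * sr 0 = 1 by decide, map_one]
  exact isLeast_card_gfaces_generate_of_dihedral_quotient' (semidirect_isPGroup N φ k hN) (semidirect_c_mul_c N φ)
    (semidirect_c_central N φ hφ) SemidirectProduct.rightHom SemidirectProduct.rightHom_surjective (SemidirectProduct.rightHom_inr _)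
    hker (SemidirectProduct.inr (sr 0)) (SemidirectProduct.rightHom_inr _) hqq

/-- **`μ = β − 2` for the split extensions `(N ⋊[φ] D₄, inr r²)`**, `|N| = 2ᵏ ≥ 2`, `r²` acting trivially. [folklore] -/
theorem isLeast_card_gfaces_generate_semidirect_block' (N : Type*) [Group N] [Fintype N] [DecidableEq N]
    (φ : DihedralGroup 4 →* MulAut N) (hφ : φ (r 2) = 1) [Fintype (N ⋊[φ] DihedralGroup 4)] (k : ℕ) (hk : 1 ≤ k)
    (hN : Fintype.card N = 2 ^ k) :
    IsLeast {n : ℕ | ∃ S : Finset (CMF (N ⋊[φ] DihedralGroup 4) (SemidirectProduct.inr (r 2)) →₀ ℤ),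
      (↑S ⊆ gfaceSet (N ⋊[φ] DihedralGroup 4) (SemidirectProduct.inr (r 2)) (semidirect_c_mul_c N φ)) ∧ S.card = n ∧
      hodgeSpan (SemidirectProduct.inr (r 2) : N ⋊[φ] DihedralGroup 4) (semidirect_c_mul_c N φ) ≤
        Submodule.span ℤ (pairSet (SemidirectProduct.inr (r 2) : N ⋊[φ] DihedralGroup 4)) ⊔
          Submodule.span ℤ (translates (SemidirectProduct.inr (r 2) : N ⋊[φ] DihedralGroup 4) S)}
      (Fintype.card (Block (SemidirectProduct.inr (r 2) : N ⋊[φ] DihedralGroup 4)) - 2) := by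
  have h := fibreTwo_add_two_eq_card_block_semidirect N φ hφ k hN
  rw [show Fintype.card (Block (SemidirectProduct.inr (r 2) : N ⋊[φ] DihedralGroup 4)) - 2 =
    fibreTwo (SemidirectProduct.inr (r 2) : N ⋊[φ] DihedralGroup 4) (semidirect_c_mul_c N φ) by omega]
  exact isLeast_card_gfaces_generate_semidirect' N φ hφ k hk hN

end

end Summit.HodgeConjecture.CorCM.Census.CentralSquares
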